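import Summits.CriticalPhenomena.PercolationContinuityZ3.Theorems.PercNearOneGluingNoHeavyPcintUFibBip
import HarnessLib

/-!
# PCINT lane, T-fibre route PHASE 2, step (4B'): the type sums of complete bipartite fibres in closed form

Cell `prim-pcint`, seat `prim-pcint-1` (gen 12); memo `run/shared/lean/prim/pcint/T-FIBRE-ROUTE.md` (PHASE 2).
Finite-sum identities, no new facts, no `sorry`.

For the usable-set rule `υB SA` of the complete bipartite fibre `K_{A,B}` (`…PcintUFibBip.lean`; sides `SA`, `SAᶜ` of
sizes `nA`, `nB`) and a type `H` with `ha = #(SA ∩ H)`, `hb = #(SAᶜ ∩ H)`, the type sum of `UFib.dominating` is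

  `Σ_x π_p(x) [meetsU x H] φ(#υB x H) = cf nA nB ha hb p φ`     (`UFib.sum_wt_meetsU_υB`), where

  `cf = Σ_{i,j ≥ 1} (C(nA,i)C(nB,j) − C(nA−ha,i)C(nB−hb,j)) p^{i+j} (1−p)^{nA+nB−i−j} φ(i+j)`   (two-sided states)
     `+ (1−p)^{nB} Σ_{a ≥ 1} C(ha,a) p^a (1−p)^{ha−a} φ(a) + (1−p)^{nA} Σ_{b ≥ 1} C(hb,b) p^b (1−p)^{hb−b} φ(b)`   (one-sided).

The proof passes to sums over finsets (`AdaptDom.sum_wt_eq_sum_finset`), splits the open set along `SA`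
(`sum_powerset_split`), and groups by cardinalities (`TFib.sum_powerset_card_eq`).  `cf` and the binomial tail `bt` are
defined over any field so that the numeric tables can be checked over `ℚ` (`…PcintUFibBipCheck.lean`).
-/

namespace Summit.CriticalPhenomena.PercolationContinuityZ3.Theorems.Pcint

namespace UFib

open Finset AdaptDom TFib

/-! ### The closed form (over any field) -/

/-- The binomial tail `P(Bin(k, r) ≥ j)` over a field (`= AdaptDom.binTail` over `ℝ`). -/
def bt {𝕜 : Type*} [Field 𝕜] (k : ℕ) (r : 𝕜) (j : ℕ) : 𝕜 :=
  ∑ ℓ ∈ range (k + 1), if j ≤ ℓ then (k.choose ℓ : 𝕜) * r ^ ℓ * (1 - r) ^ (k - ℓ) else 0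

/-- Over `ℝ`, `bt` is `AdaptDom.binTail`. -/
theorem bt_eq_binTail (k : ℕ) (r : ℝ) (j : ℕ) : bt k r j = binTail k r j := rfl

/-- **The closed form of the type sums of complete bipartite fibres** (sides `nA`, `nB`; type `(ha, hb)`). -/
def cf {𝕜 : Type*} [Field 𝕜] (nA nB ha hb : ℕ) (p : 𝕜) (φ : ℕ → 𝕜) : 𝕜 :=
  (∑ i ∈ range (nA + 1), ∑ j ∈ range (nB + 1),
      if 1 ≤ i ∧ 1 ≤ j then
        (((nA.choose i * nB.choose j : ℕ) : 𝕜) - (((nA - ha).choose i * (nB - hb).choose j : ℕ) : 𝕜)) *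
          (p ^ (i + j) * (1 - p) ^ (nA + nB - (i + j)) * φ (i + j))
      else 0) +
  (1 - p) ^ nB * (∑ a ∈ range (ha + 1), if 1 ≤ a then (ha.choose a : 𝕜) * (p ^ a * (1 - p) ^ (ha - a) * φ a) else 0) +
  (1 - p) ^ nA * (∑ b ∈ range (hb + 1), if 1 ≤ b then (hb.choose b : 𝕜) * (p ^ b * (1 - p) ^ (hb - b) * φ b) else 0)

variable {Φ : Type*} [DecidableEq Φ]

/-! ### Splitting powerset sums along a subset -/

/-- **Splitting a powerset sum along a subset**: `Σ_{B ⊆ X} g B = Σ_{B₁ ⊆ T} Σ_{B₂ ⊆ X ∖ T} g (B₁ ∪ B₂)` (`T ⊆ X`). -/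
theorem sum_powerset_split {X T : Finset Φ} (hT : T ⊆ X) (g : Finset Φ → ℝ) :
    ∑ B ∈ X.powerset, g B = ∑ B₁ ∈ T.powerset, ∑ B₂ ∈ (X \ T).powerset, g (B₁ ∪ B₂) := by
  rw [← Finset.sum_product']
  symm
  refine Finset.sum_nbij' (fun z => z.1 ∪ z.2) (fun B => (B ∩ T, B \ T)) ?_ ?_ ?_ ?_ ?_
  · rintro ⟨B₁, B₂⟩ hz
    rw [mem_product, mem_powerset, mem_powerset] at hz
    rw [mem_powerset]
    exact union_subset (hz.1.trans hT) (hz.2.trans sdiff_subset)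
  · intro B hB
    rw [mem_powerset] at hB
    rw [mem_product, mem_powerset, mem_powerset]
    exact ⟨inter_subset_right, sdiff_subset_sdiff hB le_rfl⟩
  · rintro ⟨B₁, B₂⟩ hz
    rw [mem_product, mem_powerset, mem_powerset] at hz
    dsimp only at hz ⊢
    have h2 : ∀ a ∈ B₂, a ∉ T := fun a ha haT => (mem_sdiff.1 (hz.2 ha)).2 haT
    simp only [Prod.mk.injEq]
    constructor
    · ext a; simp only [mem_inter, mem_union]
      constructor
      · rintro ⟨h | h, haT⟩
        · exact h
        · exact absurd haT (h2 a h)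
      · intro h; exact ⟨Or.inl h, hz.1 h⟩
    · ext a; simp only [mem_sdiff, mem_union]
      constructor
      · rintro ⟨h | h, haT⟩
        · exact absurd (hz.1 h) haT
        · exact h
      · intro h; exact ⟨Or.inr h, h2 a h⟩
  · intro B _
    ext a; simp only [mem_union, mem_inter, mem_sdiff]
    tauto
  · intro z _; rfl

/-- Powerset sums of a summand depending on the cardinality only, over an extended range. -/
theorem sum_powerset_card_eq_range (Y : Finset Φ) {M : ℕ} (hM : Y.card ≤ M) (t : ℕ → ℝ) :
    ∑ B ∈ Y.powerset, t B.card = ∑ i ∈ range (M + 1), (Y.card.choose i : ℝ) * t i := by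
  rw [sum_powerset_card_eq]
  have hsub : range (Y.card + 1) ⊆ range (M + 1) := range_subset_range.2 (by omega)
  rw [← Finset.sum_subset hsub]
  intro i hi hi'
  rw [mem_range] at hi hi'
  rw [Nat.choose_eq_zero_of_lt (by omega)]; simp

/-- The subsets of `Y` avoiding `H` are the subsets of `Y ∖ H`. -/
theorem filter_powerset_not_meet (Y H : Finset Φ) :
    Y.powerset.filter (fun B => ¬ (B ∩ H).Nonempty) = (Y \ H).powerset := by
  ext B
  simp only [mem_filter, mem_powerset, not_nonempty_iff_eq_empty, subset_sdiff, disjoint_iff_inter_eq_empty]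

/-! ### The one-sided sum -/

/-- **The one-sided type sum**: `Σ_{B ⊆ Y} p^{#B} (1-p)^{#Y-#B} [B ∩ H ≠ ∅] ψ(#(B ∩ H)) =
Σ_{1 ≤ a ≤ #(Y∩H)} C(#(Y∩H), a) p^a (1-p)^{#(Y∩H)-a} ψ(a)` (the cells of `Y ∖ H` integrate out). -/
theorem sum_powerset_oneSided (Y H : Finset Φ) (p : ℝ) (ψ : ℕ → ℝ) :
    ∑ B ∈ Y.powerset, p ^ B.card * (1 - p) ^ (Y.card - B.card) * (if (B ∩ H).Nonempty then ψ (B ∩ H).card else 0) =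
      ∑ a ∈ range ((Y ∩ H).card + 1),
        if 1 ≤ a then ((Y ∩ H).card.choose a : ℝ) * (p ^ a * (1 - p) ^ ((Y ∩ H).card - a) * ψ a) else 0 := by
  rw [sum_powerset_split (inter_subset_left : Y ∩ H ⊆ Y)]
  have hYd : Y \ (Y ∩ H) = Y \ H := by
    ext a; simp only [mem_sdiff, mem_inter]; tauto
  rw [hYd]
  -- simplify the summand for `B₁ ⊆ Y ∩ H`, `B₂ ⊆ Y \ H`
  have key : ∀ B₁ ∈ (Y ∩ H).powerset, ∀ B₂ ∈ (Y \ H).powerset,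
      p ^ (B₁ ∪ B₂).card * (1 - p) ^ (Y.card - (B₁ ∪ B₂).card) *
          (if ((B₁ ∪ B₂) ∩ H).Nonempty then ψ ((B₁ ∪ B₂) ∩ H).card else 0) =
        (if B₁.Nonempty then p ^ B₁.card * (1 - p) ^ ((Y ∩ H).card - B₁.card) * ψ B₁.card else 0) *
          (p ^ B₂.card * (1 - p) ^ ((Y \ H).card - B₂.card)) := by
    intro B₁ h1 B₂ h2
    rw [mem_powerset] at h1 h2
    have hdisj : Disjoint B₁ B₂ := by
      rw [Finset.disjoint_left]
      intro a ha1 ha2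
      exact (mem_sdiff.1 (h2 ha2)).2 (mem_inter.1 (h1 ha1)).2
    have hcard : (B₁ ∪ B₂).card = B₁.card + B₂.card := card_union_of_disjoint hdisj
    have hint : (B₁ ∪ B₂) ∩ H = B₁ := by
      ext a; simp only [mem_inter, mem_union]
      constructor
      · rintro ⟨ha | ha, haH⟩
        · exact ha
        · exact absurd haH (mem_sdiff.1 (h2 ha)).2
      · intro ha; exact ⟨Or.inl ha, (mem_inter.1 (h1 ha)).2⟩
    rw [hint, hcard]
    have hc1 : B₁.card ≤ (Y ∩ H).card := card_le_card h1
    have hc2 : B₂.card ≤ (Y \ H).card := card_le_card h2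
    have hY : Y.card = (Y ∩ H).card + (Y \ H).card := by
      have := Finset.card_sdiff_add_card_inter Y H; omega
    have hexp : Y.card - (B₁.card + B₂.card) = ((Y ∩ H).card - B₁.card) + ((Y \ H).card - B₂.card) := by omega
    rw [hexp, pow_add, pow_add]
    by_cases hB : B₁.Nonempty
    · rw [if_pos hB, if_pos hB]; ring
    · rw [if_neg hB, if_neg hB]; ring
  rw [Finset.sum_congr rfl fun B₁ h1 => Finset.sum_congr rfl fun B₂ h2 => key B₁ h1 B₂ h2]
  simp_rw [← Finset.mul_sum]
  rw [Finset.sum_pow_mul_eq_add_pow, add_sub_cancel, one_pow]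
  simp only [mul_one]
  -- group by cardinality
  have e := sum_powerset_card_eq (Y ∩ H)
    (fun a => if 1 ≤ a then p ^ a * (1 - p) ^ ((Y ∩ H).card - a) * ψ a else 0)
  have e' : ∑ B₁ ∈ (Y ∩ H).powerset,
      (if B₁.Nonempty then p ^ B₁.card * (1 - p) ^ ((Y ∩ H).card - B₁.card) * ψ B₁.card else 0) =
      ∑ B₁ ∈ (Y ∩ H).powerset,
        (if 1 ≤ B₁.card then p ^ B₁.card * (1 - p) ^ ((Y ∩ H).card - B₁.card) * ψ B₁.card else 0) :=
    Finset.sum_congr rfl fun B₁ _ => by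
      simp only [Nat.one_le_iff_ne_zero, Ne, card_eq_zero, ← nonempty_iff_ne_empty]
  rw [e', e]
  refine Finset.sum_congr rfl fun a _ => ?_
  by_cases ha : 1 ≤ a
  · rw [if_pos ha, if_pos ha]
  · rw [if_neg ha, if_neg ha, mul_zero]

/-! ### Double powerset sums -/

/-- Double powerset sums of a summand depending on the two cardinalities, grouped by cardinalities. -/
theorem sum_powerset_powerset_card (Y Z : Finset Φ) {M M' : ℕ} (hM : Y.card ≤ M) (hM' : Z.card ≤ M')
    (Q : ℕ → ℕ → ℝ) :
    ∑ B ∈ Y.powerset, ∑ C ∈ Z.powerset, Q B.card C.card =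
      ∑ i ∈ range (M + 1), ∑ j ∈ range (M' + 1), (Y.card.choose i : ℝ) * ((Z.card.choose j : ℝ) * Q i j) := by
  have inner : ∀ B ∈ Y.powerset, ∑ C ∈ Z.powerset, Q B.card C.card =
      ∑ j ∈ range (M' + 1), (Z.card.choose j : ℝ) * Q B.card j :=
    fun B _ => sum_powerset_card_eq_range Z hM' (Q B.card)
  rw [Finset.sum_congr rfl inner,
    sum_powerset_card_eq_range Y hM (fun i => ∑ j ∈ range (M' + 1), (Z.card.choose j : ℝ) * Q i j)]
  exact Finset.sum_congr rfl fun i _ => by rw [Finset.mul_sum]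

/-- Double powerset sums restricted to the subsets avoiding `H`. -/
theorem sum_powerset_powerset_card_avoid (Y Z H : Finset Φ) {M M' : ℕ} (hM : Y.card ≤ M) (hM' : Z.card ≤ M')
    (Q : ℕ → ℕ → ℝ) :
    ∑ B ∈ Y.powerset, ∑ C ∈ Z.powerset,
        (if ¬ (B ∩ H).Nonempty ∧ ¬ (C ∩ H).Nonempty then Q B.card C.card else 0) =
      ∑ i ∈ range (M + 1), ∑ j ∈ range (M' + 1),
        ((Y.card - (Y ∩ H).card).choose i : ℝ) * (((Z.card - (Z ∩ H).card).choose j : ℝ) * Q i j) := by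
  have e1 : ∀ B ∈ Y.powerset, ∑ C ∈ Z.powerset,
      (if ¬ (B ∩ H).Nonempty ∧ ¬ (C ∩ H).Nonempty then Q B.card C.card else 0) =
      if ¬ (B ∩ H).Nonempty then ∑ C ∈ (Z \ H).powerset, Q B.card C.card else 0 := by
    intro B _
    by_cases hB : ¬ (B ∩ H).Nonempty
    · rw [if_pos hB, ← filter_powerset_not_meet Z H, Finset.sum_filter]
      refine Finset.sum_congr rfl fun C _ => ?_
      by_cases hC : ¬ (C ∩ H).Nonempty
      · rw [if_pos ⟨hB, hC⟩, if_pos hC]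
      · rw [if_neg (fun h => hC h.2), if_neg hC]
    · rw [if_neg hB]
      exact Finset.sum_eq_zero fun C _ => by rw [if_neg (fun h => hB h.1)]
  rw [Finset.sum_congr rfl e1, ← Finset.sum_filter, filter_powerset_not_meet Y H]
  have hM1 : (Y \ H).card ≤ M := (card_le_card sdiff_subset).trans hM
  have hM2 : (Z \ H).card ≤ M' := (card_le_card sdiff_subset).trans hM'
  have hY : (Y \ H).card = Y.card - (Y ∩ H).card := by have := Finset.card_sdiff_add_card_inter Y H; omega
  have hZ : (Z \ H).card = Z.card - (Z ∩ H).card := by have := Finset.card_sdiff_add_card_inter Z H; omega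
  rw [sum_powerset_powerset_card (Y \ H) (Z \ H) hM1 hM2 Q, hY, hZ]

/-! ### The closed form -/

section Main

variable [Fintype Φ] (SA : Finset Φ) (p : ℝ) (H : Finset Φ) (φ : ℕ → ℝ)

/-- The summand of the type sum on the split open set `B ∪ C` (`B ⊆ SA`, `C ⊆ SAᶜ`), as two-sided part minus its
`H`-avoiding part plus the two one-sided parts. -/
theorem summand_split {B C : Finset Φ} (hB : B ⊆ SA) (hC : C ⊆ SAᶜ) :
    p ^ (B ∪ C).card * (1 - p) ^ (Fintype.card Φ - (B ∪ C).card) *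
        (if ((B ∪ C) ∩ H).Nonempty then
          (if ((B ∪ C) ∩ SA).Nonempty ∧ ((B ∪ C) \ SA).Nonempty then φ (B ∪ C).card else φ ((B ∪ C) ∩ H).card)
         else 0) =
      (if 1 ≤ B.card ∧ 1 ≤ C.card then
          p ^ (B.card + C.card) * (1 - p) ^ (SA.card + SAᶜ.card - (B.card + C.card)) * φ (B.card + C.card) else 0)
      - (if ¬ (B ∩ H).Nonempty ∧ ¬ (C ∩ H).Nonempty then
          (if 1 ≤ B.card ∧ 1 ≤ C.card then
            p ^ (B.card + C.card) * (1 - p) ^ (SA.card + SAᶜ.card - (B.card + C.card)) * φ (B.card + C.card) else 0)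
         else 0)
      + (if C = ∅ then (1 - p) ^ SAᶜ.card *
          (p ^ B.card * (1 - p) ^ (SA.card - B.card) * (if (B ∩ H).Nonempty then φ (B ∩ H).card else 0)) else 0)
      + (if B = ∅ then (1 - p) ^ SA.card *
          (p ^ C.card * (1 - p) ^ (SAᶜ.card - C.card) * (if (C ∩ H).Nonempty then φ (C ∩ H).card else 0)) else 0) := by
  have hN : Fintype.card Φ = SA.card + SAᶜ.card := (Finset.card_add_card_compl SA).symm
  have hdisj : Disjoint B C := by
    rw [Finset.disjoint_left]; intro a haB haC; exact (mem_compl.1 (hC haC)) (hB haB)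
  have hcard : (B ∪ C).card = B.card + C.card := card_union_of_disjoint hdisj
  have hU1 : (B ∪ C) ∩ SA = B := by
    ext a; simp only [mem_inter, mem_union]
    constructor
    · rintro ⟨ha | ha, haS⟩
      · exact ha
      · exact absurd haS (mem_compl.1 (hC ha))
    · intro ha; exact ⟨Or.inl ha, hB ha⟩
  have hU2 : (B ∪ C) \ SA = C := by
    ext a; simp only [mem_sdiff, mem_union]
    constructor
    · rintro ⟨ha | ha, haS⟩
      · exact absurd (hB ha) haS
      · exact ha
    · intro ha; exact ⟨Or.inr ha, mem_compl.1 (hC ha)⟩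
  have hcB : B.card ≤ SA.card := card_le_card hB
  have hcC : C.card ≤ SAᶜ.card := card_le_card hC
  have hne : ∀ D : Finset Φ, D.Nonempty ↔ 1 ≤ D.card := fun D => by
    rw [Nat.one_le_iff_ne_zero, Ne, card_eq_zero, nonempty_iff_ne_empty]
  by_cases hBn : B.Nonempty
  · by_cases hCn : C.Nonempty
    · -- two-sided
      rw [hN, hcard, hU1, hU2]
      have h11 : 1 ≤ B.card ∧ 1 ≤ C.card := ⟨(hne B).1 hBn, (hne C).1 hCn⟩
      have hbc : B.Nonempty ∧ C.Nonempty := ⟨hBn, hCn⟩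
      have hCe : ¬ C = ∅ := hCn.ne_empty
      have hBe : ¬ B = ∅ := hBn.ne_empty
      rw [if_pos hbc, if_pos h11, if_neg hCe, if_neg hBe]
      have hmeet : ((B ∪ C) ∩ H).Nonempty ↔ ¬ (¬ (B ∩ H).Nonempty ∧ ¬ (C ∩ H).Nonempty) := by
        rw [union_inter_distrib_right, union_nonempty]; tauto
      by_cases hm : ¬ (B ∩ H).Nonempty ∧ ¬ (C ∩ H).Nonempty
      · have hm' : ¬ ((B ∪ C) ∩ H).Nonempty := fun h => hmeet.1 h hm
        rw [if_neg hm', if_pos hm]; ring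
      · rw [if_pos (hmeet.2 hm), if_neg hm]; ring
    · -- one-sided `A`: `C = ∅`
      have hC0 : C = ∅ := not_nonempty_iff_eq_empty.1 hCn
      subst hC0
      rw [union_empty, hN]
      have h11 : ¬ (1 ≤ B.card ∧ 1 ≤ (∅ : Finset Φ).card) := by simp
      have hts : ¬ ((B ∩ SA).Nonempty ∧ (B \ SA).Nonempty) := by
        rintro ⟨-, h⟩
        rw [Finset.sdiff_eq_empty_iff_subset.2 hB] at h
        exact Finset.not_nonempty_empty h
      have hBe : ¬ B = ∅ := hBn.ne_empty
      rw [if_neg h11, if_neg hts, if_pos rfl, if_neg hBe]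
      have hexp : SA.card + SAᶜ.card - B.card = SAᶜ.card + (SA.card - B.card) := by omega
      rw [hexp, pow_add]
      simp only [ite_self]
      by_cases hm : (B ∩ H).Nonempty
      · simp only [if_pos hm]; ring
      · simp only [if_neg hm]; ring
  · have hB0 : B = ∅ := not_nonempty_iff_eq_empty.1 hBn
    subst hB0
    by_cases hCn : C.Nonempty
    · -- one-sided `B`
      rw [empty_union, hN]
      have h11 : ¬ (1 ≤ (∅ : Finset Φ).card ∧ 1 ≤ C.card) := by simp
      have hCS : C ∩ SA = ∅ := by
        ext a
        simp only [mem_inter, Finset.notMem_empty, iff_false, not_and]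
        intro haC haS
        exact (mem_compl.1 (hC haC)) haS
      have hts : ¬ ((C ∩ SA).Nonempty ∧ (C \ SA).Nonempty) := by
        rintro ⟨h, -⟩
        rw [hCS] at h
        exact Finset.not_nonempty_empty h
      have hCe : ¬ C = ∅ := hCn.ne_empty
      rw [if_neg h11, if_neg hts, if_neg hCe, if_pos rfl]
      have hexp : SA.card + SAᶜ.card - C.card = SA.card + (SAᶜ.card - C.card) := by omega
      rw [hexp, pow_add]
      simp only [ite_self]
      by_cases hm : (C ∩ H).Nonempty
      · simp only [if_pos hm]; ring
      · simp only [if_neg hm]; ring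
    · have hC0 : C = ∅ := not_nonempty_iff_eq_empty.1 hCn
      subst hC0
      simp

/-- **The type sums of complete bipartite fibres in closed form.** -/
theorem sum_wt_meetsU_υB :
    ∑ x : Φ → Bool, wt p x * ((if meetsU x H = true then (1 : ℝ) else 0) * φ (υB SA x H).card) =
      cf SA.card SAᶜ.card (SA ∩ H).card (SAᶜ ∩ H).card p φ := by
  classical
  -- step 1: sums over finsets
  rw [sum_wt_eq_sum_finset]
  have hG : ∀ A : Finset Φ, (if meetsU (indB A) H = true then (1 : ℝ) else 0) * φ (υB SA (indB A) H).card =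
      (if (A ∩ H).Nonempty then
        (if (A ∩ SA).Nonempty ∧ (A \ SA).Nonempty then φ A.card else φ (A ∩ H).card) else 0) := by
    intro A
    rw [card_υB_indB]
    by_cases h1 : (A ∩ H).Nonempty
    · rw [if_pos ((meetsU_indB_iff A H).2 h1), if_pos h1, if_pos h1, one_mul, apply_ite φ]
    · have h1' : ¬ meetsU (indB A) H = true := fun h => h1 ((meetsU_indB_iff A H).1 h)
      rw [if_neg h1', if_neg h1, zero_mul, if_neg h1]
  simp only [hG]
  -- step 2: split the open set along `SA`
  rw [← Finset.powerset_univ, sum_powerset_split (subset_univ SA)]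
  have hSB : (univ : Finset Φ) \ SA = SAᶜ := (Finset.compl_eq_univ_sdiff SA).symm
  rw [hSB]
  rw [Finset.sum_congr rfl fun B hB => Finset.sum_congr rfl fun C hC =>
    summand_split SA p H φ (mem_powerset.1 hB) (mem_powerset.1 hC)]
  -- step 3: evaluate the four parts
  simp only [Finset.sum_add_distrib, Finset.sum_sub_distrib]
  have hA : (SA ∩ H).card ≤ SA.card := card_le_card inter_subset_left
  have hBc : (SAᶜ ∩ H).card ≤ SAᶜ.card := card_le_card inter_subset_left
  -- (a) two-sided
  rw [sum_powerset_powerset_card SA SAᶜ le_rfl le_rfl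
    (fun i j => if 1 ≤ i ∧ 1 ≤ j then p ^ (i + j) * (1 - p) ^ (SA.card + SAᶜ.card - (i + j)) * φ (i + j) else 0)]
  -- (b) two-sided, avoiding `H`
  rw [sum_powerset_powerset_card_avoid SA SAᶜ H le_rfl le_rfl
    (fun i j => if 1 ≤ i ∧ 1 ≤ j then p ^ (i + j) * (1 - p) ^ (SA.card + SAᶜ.card - (i + j)) * φ (i + j) else 0)]
  -- (c) one-sided `A`: only `C = ∅` contributes
  have hc : ∑ B ∈ SA.powerset, ∑ C ∈ SAᶜ.powerset,
      (if C = ∅ then (1 - p) ^ SAᶜ.card *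
        (p ^ B.card * (1 - p) ^ (SA.card - B.card) * (if (B ∩ H).Nonempty then φ (B ∩ H).card else 0)) else 0) =
      (1 - p) ^ SAᶜ.card * ∑ a ∈ range ((SA ∩ H).card + 1),
        (if 1 ≤ a then ((SA ∩ H).card.choose a : ℝ) * (p ^ a * (1 - p) ^ ((SA ∩ H).card - a) * φ a) else 0) := by
    rw [← sum_powerset_oneSided SA H p φ, Finset.mul_sum]
    refine Finset.sum_congr rfl fun B _ => ?_
    rw [Finset.sum_ite_eq' (SAᶜ.powerset) ∅, if_pos (empty_mem_powerset _)]
  -- (d) one-sided `B`: only `B = ∅` contributes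
  have hd : ∑ B ∈ SA.powerset, ∑ C ∈ SAᶜ.powerset,
      (if B = ∅ then (1 - p) ^ SA.card *
        (p ^ C.card * (1 - p) ^ (SAᶜ.card - C.card) * (if (C ∩ H).Nonempty then φ (C ∩ H).card else 0)) else 0) =
      (1 - p) ^ SA.card * ∑ b ∈ range ((SAᶜ ∩ H).card + 1),
        (if 1 ≤ b then ((SAᶜ ∩ H).card.choose b : ℝ) * (p ^ b * (1 - p) ^ ((SAᶜ ∩ H).card - b) * φ b) else 0) := by
    rw [Finset.sum_comm, ← sum_powerset_oneSided SAᶜ H p φ, Finset.mul_sum]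
    refine Finset.sum_congr rfl fun C _ => ?_
    rw [Finset.sum_ite_eq' (SA.powerset) ∅, if_pos (empty_mem_powerset _)]
  rw [hc, hd]
  -- assemble
  unfold cf
  congr 1; congr 1
  rw [← Finset.sum_sub_distrib]
  refine Finset.sum_congr rfl fun i _ => ?_
  rw [← Finset.sum_sub_distrib]
  refine Finset.sum_congr rfl fun j _ => ?_
  by_cases hij : 1 ≤ i ∧ 1 ≤ j
  · rw [if_pos hij, if_pos hij]; push_cast; ring
  · rw [if_neg hij, if_neg hij]; ring

end Main

end UFib

end Summit.CriticalPhenomena.PercolationContinuityZ3.Theorems.Pcint
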